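import Mathlib.Data.Nat.Choose.Sum
import Summits.Ventures.PercRepro.RankLevelSetAvgTopS
import Summits.Ventures.PercRepro.RankLevelSetAvgMultS

/-!
# PercRepro — [re-pointed at the primed (`_S`) parents per (um)(35)(2)–(4); the landed originals are the citations]
# THE MULTIPLICITY COUNT OF PART 2 (night-1, gen 9 session 4; dossier §19.12 (d), `m̄(s₁,s₂)`)

A `q`-subset `B` of a disjoint union `T_F ⊔ S₂` with `|B ∩ S₂| ≤ c` is one of at most
`Σ_{j ≤ c} C(|S₂|, j)·C(|T_F|, q − j)` sets (`card_filter_inter_le`).  For a member `s` of `U(p,q)`, the flat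
`F = cl(E ∖ s)`, `K = F ∖ (E ∖ s)`, `k = |K|`, and a supply set `T = (E ∖ s) ∪ S₁ ∪ S₂` (`S₁ ⊆ K`, `S₂ ⊆ s ∖ F`), every
member `s′` with `E ∖ s′ ⊆ T` gives such a `B = E ∖ s′` with `c = q − k` (the multiplicity lemma), so the number of
members inside `T` is at most `m̄(|S₁|, |S₂|) = Σ_{j ≤ q−k} C(|S₂|, j)·C(q + |S₁|, q − j)` (`card_members_subset_le`).

Axioms: standard.
-/

namespace PercRepro

open Finset

/-- The number of `q`-subsets `B` of `T_F ∪ S₂` (`T_F`, `S₂` disjoint) with `|B ∩ S₂| ≤ c`. -/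
lemma card_filter_inter_le {β : Type} [DecidableEq β] (TF S₂ : Finset β) (hd : Disjoint TF S₂) (q c : ℕ) :
    (((TF ∪ S₂).powersetCard q).filter (fun B => (B ∩ S₂).card ≤ c)).card ≤
      ∑ j ∈ Finset.range (c + 1), (S₂.card.choose j) * (TF.card.choose (q - j)) := by
  set P := ((TF ∪ S₂).powersetCard q).filter (fun B => (B ∩ S₂).card ≤ c) with hP
  have hmaps : (P : Set (Finset β)).MapsTo (fun B => (B ∩ S₂).card) (Finset.range (c + 1)) := by
    intro B hB
    rw [Finset.mem_coe, hP, Finset.mem_filter] at hB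
    rw [Finset.mem_coe, Finset.mem_range]
    show (B ∩ S₂).card < c + 1
    omega
  rw [Finset.card_eq_sum_card_fiberwise hmaps]
  refine Finset.sum_le_sum (fun j _ => ?_)
  -- the fibre injects into `S₂.powersetCard j ×ˢ TF.powersetCard (q − j)`
  have hinj : Set.InjOn (fun B : Finset β => (B ∩ S₂, B ∩ TF)) ↑(P.filter (fun B => (B ∩ S₂).card = j)) := by
    intro B hB B' hB' h
    simp only [Finset.coe_filter, hP, Finset.mem_filter, Finset.mem_powersetCard, Set.mem_setOf_eq] at hB hB'
    simp only [Prod.mk.injEq] at h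
    have hB1 : B = (B ∩ S₂) ∪ (B ∩ TF) := by
      rw [← Finset.inter_union_distrib_left, Finset.union_comm, Finset.inter_eq_left.2 hB.1.1.1]
    have hB2 : B' = (B' ∩ S₂) ∪ (B' ∩ TF) := by
      rw [← Finset.inter_union_distrib_left, Finset.union_comm, Finset.inter_eq_left.2 hB'.1.1.1]
    rw [hB1, hB2, h.1, h.2]
  have hmaps2 : ∀ B ∈ P.filter (fun B => (B ∩ S₂).card = j),
      (B ∩ S₂, B ∩ TF) ∈ S₂.powersetCard j ×ˢ TF.powersetCard (q - j) := by
    intro B hB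
    simp only [hP, Finset.mem_filter, Finset.mem_powersetCard] at hB
    obtain ⟨⟨⟨hBT, hBq⟩, -⟩, hBj⟩ := hB
    rw [Finset.mem_product, Finset.mem_powersetCard, Finset.mem_powersetCard]
    refine ⟨⟨Finset.inter_subset_right, hBj⟩, Finset.inter_subset_right, ?_⟩
    show (B ∩ TF).card = q - j
    -- `|B ∩ TF| = |B| − |B ∩ S₂|`
    have hsplit : B = (B ∩ TF) ∪ (B ∩ S₂) := by
      rw [← Finset.inter_union_distrib_left, Finset.inter_eq_left.2 hBT]
    have hdisj : Disjoint (B ∩ TF) (B ∩ S₂) :=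
      hd.mono Finset.inter_subset_right Finset.inter_subset_right
    have hcard : B.card = (B ∩ TF).card + (B ∩ S₂).card := by
      conv_lhs => rw [hsplit]
      exact Finset.card_union_of_disjoint hdisj
    omega
  calc (P.filter (fun B => (B ∩ S₂).card = j)).card
      = ((P.filter (fun B => (B ∩ S₂).card = j)).image (fun B => (B ∩ S₂, B ∩ TF))).card :=
        (Finset.card_image_of_injOn hinj).symm
    _ ≤ (S₂.powersetCard j ×ˢ TF.powersetCard (q - j)).card := by
        apply Finset.card_le_card
        intro y hy
        rw [Finset.mem_image] at hy
        obtain ⟨B, hB, rfl⟩ := hy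
        exact hmaps2 B hB
    _ = (S₂.card.choose j) * (TF.card.choose (q - j)) := by
        rw [Finset.card_product, Finset.card_powersetCard, Finset.card_powersetCard]


open Set in
open scoped Classical in
/-- **THE MULTIPLICITY COUNT**: on the tight layer, for `A ∈ U(p,q)` with `F = cl(E ∖ A)`, a finset `S₁` of elements of
`F ∖ (E ∖ A)` and a finset `S₂` of elements of `A ∖ F`, the members `A′` of `U(p,q)` with `E ∖ A′ ⊆ (E ∖ A) ∪ S₁ ∪ S₂`
number at most `Σ_{j ≤ q − k} C(|S₂|, j)·C(q + |S₁|, q − j)`, `k = |F ∖ (E ∖ A)|`. -/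
theorem card_members_subset_le {α : Type} (M : Matroid α) [M.Finite] {p q : ℕ} (hE : M.E.ncard = p + q)
    {A : Set α} (hA : A ∈ Uset M p q) (S₁ S₂ : Finset α)
    (hS₁ : (S₁ : Set α) ⊆ M.closure (M.E \ A) \ (M.E \ A)) (hS₂ : (S₂ : Set α) ⊆ A \ M.closure (M.E \ A)) :
    ((Uset_finite_S M p q).toFinset.filter
        (fun A' => M.E \ A' ⊆ (M.E \ A) ∪ (S₁ : Set α) ∪ (S₂ : Set α))).card ≤
      ∑ j ∈ Finset.range (q - (M.closure (M.E \ A) \ (M.E \ A)).ncard + 1),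
        (S₂.card.choose j) * ((q + S₁.card).choose (q - j)) := by
  have hEfin : M.E.Finite := M.set_finite M.E
  set F := M.closure (M.E \ A) with hF
  set k := (F \ (M.E \ A)).ncard with hk
  have hAcfin : (M.E \ A).Finite := hEfin.subset sdiff_subset
  set Ac : Finset α := hAcfin.toFinset with hAc
  have hAc_card : Ac.card = q := by
    rw [hAc, ← Set.ncard_eq_toFinset_card _ hAcfin]
    exact (ncard_compl_eq_of_mem_Uset_S M hE hA).2
  set TF : Finset α := Ac ∪ S₁ with hTF
  have hTF_card : TF.card = q + S₁.card := by
    rw [hTF, Finset.card_union_of_disjoint, hAc_card]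
    rw [Finset.disjoint_left]
    intro x hx hxS
    rw [hAc, Set.Finite.mem_toFinset] at hx
    exact (hS₁ hxS).2 hx
  have hdisj : Disjoint TF S₂ := by
    rw [Finset.disjoint_left]
    intro x hx hxS
    have hxF : x ∈ F := by
      rw [hTF, Finset.mem_union] at hx
      rcases hx with hx | hx
      · rw [hAc, Set.Finite.mem_toFinset] at hx
        exact M.subset_closure _ sdiff_subset hx
      · exact (hS₁ hx).1
    exact (hS₂ hxS).2 hxF
  -- the injection `A′ ↦ (E ∖ A′).toFinset`
  set P := (Uset_finite_S M p q).toFinset.filter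
    (fun A' => M.E \ A' ⊆ (M.E \ A) ∪ (S₁ : Set α) ∪ (S₂ : Set α)) with hP
  have hmem : ∀ A' ∈ P, A' ∈ Uset M p q ∧ M.E \ A' ⊆ (M.E \ A) ∪ (S₁ : Set α) ∪ (S₂ : Set α) := by
    intro A' hA'
    rw [hP, Finset.mem_filter, Set.Finite.mem_toFinset] at hA'
    exact hA'
  let f : Set α → Finset α := fun A' => (hEfin.subset (sdiff_subset : M.E \ A' ⊆ M.E)).toFinset
  have hf : ∀ A', ((f A' : Finset α) : Set α) = M.E \ A' := fun A' => Set.Finite.coe_toFinset _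
  have hinj : Set.InjOn f ↑P := by
    intro A' hA' A'' hA'' h
    have h1 : M.E \ A' = M.E \ A'' := by rw [← hf A', ← hf A'', h]
    have hA'E : A' ⊆ M.E := (hmem A' hA').1.1
    have hA''E : A'' ⊆ M.E := (hmem A'' hA'').1.1
    rw [← Set.sdiff_sdiff_cancel_left hA'E, ← Set.sdiff_sdiff_cancel_left hA''E, h1]
  have hmaps : ∀ A' ∈ P, f A' ∈ ((TF ∪ S₂).powersetCard q).filter (fun B => (B ∩ S₂).card ≤ q - k) := by
    intro A' hA'
    obtain ⟨hA'U, hsub⟩ := hmem A' hA'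
    rw [Finset.mem_filter, Finset.mem_powersetCard]
    refine ⟨⟨?_, ?_⟩, ?_⟩
    · -- `E ∖ A′ ⊆ T`
      intro x hx
      have hx' : x ∈ M.E \ A' := by rw [← hf A']; exact hx
      have := hsub hx'
      rw [Finset.mem_union, hTF, Finset.mem_union]
      rcases this with (hx1 | hx1) | hx1
      · left; left; rw [hAc, Set.Finite.mem_toFinset]; exact hx1
      · left; right; exact hx1
      · right; exact hx1
    · -- `|E ∖ A′| = q`
      rw [← Set.ncard_eq_toFinset_card _ (hEfin.subset sdiff_subset)]
      exact (ncard_compl_eq_of_mem_Uset_S M hE hA'U).2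
    · -- `|(E ∖ A′) ∩ S₂| ≤ q − k` by the multiplicity lemma
      have hmult := ncard_sdiff_closure_add_excess_le_S M hE hA hA'U
      rw [← hF, ← hk] at hmult
      have hsub2 : ((f A' ∩ S₂ : Finset α) : Set α) ⊆ (M.E \ A') \ F := by
        intro x hx
        rw [Finset.coe_inter, hf A'] at hx
        exact ⟨hx.1, (hS₂ hx.2).2⟩
      have hle : (f A' ∩ S₂).card ≤ ((M.E \ A') \ F).ncard := by
        rw [← Set.ncard_coe_finset]
        exact Set.ncard_le_ncard hsub2 (hEfin.subset (sdiff_subset.trans sdiff_subset))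
      omega
  calc P.card = (P.image f).card := (Finset.card_image_of_injOn hinj).symm
    _ ≤ (((TF ∪ S₂).powersetCard q).filter (fun B => (B ∩ S₂).card ≤ q - k)).card := by
        apply Finset.card_le_card
        intro y hy
        rw [Finset.mem_image] at hy
        obtain ⟨A', hA', rfl⟩ := hy
        exact hmaps A' hA'
    _ ≤ ∑ j ∈ Finset.range (q - k + 1), (S₂.card.choose j) * (TF.card.choose (q - j)) :=
        card_filter_inter_le TF S₂ hdisj q (q - k)
    _ = ∑ j ∈ Finset.range (q - k + 1), (S₂.card.choose j) * ((q + S₁.card).choose (q - j)) := by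
        rw [hTF_card]

end PercRepro
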